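import Summits.RiemannHypothesis.RiemannHypothesis.Theses.WeilComb
import Summits.RiemannHypothesis.RiemannHypothesis.Theorems.FejerDivisorPositivity
import Summits.RiemannHypothesis.RiemannHypothesis.Theorems.WeilCombCombShapePositivityStubReductionLocal
import Literature.NumberTheory.LFunctions.WeilExplicit
import Literature.NumberTheory.LFunctions.WeilMellinBounds

/-!
# `FejerDivisorPositivity` is equivalent to every family of its faces that is co-final in the level `n`
(crux `WeilComb.CombShapePositivity`, item stmt-RiemannHypothesis-11229, stub-plan `STUB-PLAN-stub_fejer.md`,
tier T5a "n-cofinality"; sprove seat)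

For each `ε > 0` and each finite set of primes `S` let a threshold `n₀ ε S` be given. If the Fejér faces
`0 ≤ Re Σ_{d,d' ∣ ∏_{p∈S} p^n} χ_θ(d) conj χ_θ(d') W(τ_{log d − log d'}(φ_ε ⋆ φ̃_ε))` hold for all `n ≥ n₀ ε S` (and all
`θ`), then they hold for ALL `n`: the face at level `n` is the node form of the comb symbol on the node set of the
divisors of `∏ p^n` with coefficients `χ_θ`, and the S-local EVENTUAL product-vector reduction `reduction_local`
(`…StubReductionLocal.lean`) recovers every such node form from the faces of large level. Hence
"induction on `n`" / "perturbing off the proved window `ε·∏p^n ≤ 1/128`" has no sub-RH rung: every co-final tail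
is the whole (RH-equivalent) statement — the `n`-analogue of `combShapePositivity_iff_cofinal`.
-/

noncomputable section

-- the sub-problem path RiemannHypothesis/RiemannHypothesis duplicates a namespace (D-0017)
set_option linter.dupNamespace false

open scoped BigOperators ComplexConjugate Real
open Complex

namespace Summit.RiemannHypothesis.RiemannHypothesis.Theorems.WeilCombBohrFejer

open Literature.NumberTheory.LFunctions

/-- **`fejerDivisorPositivity_iff_eventually_n`** (registered helper of crux stmt-RiemannHypothesis-11229, plan T5a):
for ANY threshold function `n₀`, `FejerDivisorPositivity` is equivalent to its faces of level `n ≥ n₀ ε S`.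
[folklore] -/
theorem fejerDivisorPositivity_iff_eventually_n : ∀ n₀ : ℝ → Finset ℕ → ℕ,
    Summit.RiemannHypothesis.RiemannHypothesis.Theorems.FejerDivisorPositivity ↔
      ∀ ε : ℝ, 0 < ε → ∀ S : Finset ℕ, (∀ p ∈ S, p.Prime) → ∀ n : ℕ, n₀ ε S ≤ n → ∀ θ : ℕ → ℝ,
        0 ≤ (∑ d ∈ (∏ p ∈ S, p ^ n).divisors, ∑ d' ∈ (∏ p ∈ S, p ^ n).divisors,
          Complex.exp (I * ((∑ p ∈ S, θ p * (d.factorization p : ℝ) : ℝ) : ℂ)) *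
            conj (Complex.exp (I * ((∑ p ∈ S, θ p * (d'.factorization p : ℝ) : ℝ) : ℂ))) *
            weilFunctional (weilTranslate
              (weilConv (fun t : ℝ => (ε : ℂ)⁻¹ * ((expNegInvGlue (1 - (t / ε) ^ 2) : ℝ) : ℂ))
                (weilReflect (fun t : ℝ => (ε : ℂ)⁻¹ * ((expNegInvGlue (1 - (t / ε) ^ 2) : ℝ) : ℂ))))
              (Real.log (d : ℝ) - Real.log (d' : ℝ)))).re := by
  intro n₀
  constructor
  · intro h ε hε S hS n _ θ
    exact h ε hε S hS n θ
  · intro h ε hε S hS n θ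
    -- the face of level `n` is the node form on the divisors of `∏ p^n` with coefficients `χ_θ`
    have hT : ∀ m ∈ (∏ p ∈ S, p ^ n).divisors, m ≠ 0 ∧ m.primeFactors ⊆ S := by
      intro m hm
      have hm0 : m ≠ 0 := (Nat.pos_of_mem_divisors hm).ne'
      refine ⟨hm0, fun q hq => ?_⟩
      have hqm : q ∣ m := Nat.dvd_of_mem_primeFactors hq
      have hqp : q.Prime := Nat.prime_of_mem_primeFactors hq
      have hqN : q ∣ ∏ p ∈ S, p ^ n := hqm.trans (Nat.dvd_of_mem_divisors hm)
      obtain ⟨p, hp, hqpp⟩ := (Prime.dvd_finsetProd_iff hqp.prime _).1 hqN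
      have : q = p := (Nat.prime_dvd_prime_iff_eq hqp (hS p hp)).1 (hqp.dvd_of_dvd_pow hqpp)
      exact this ▸ hp
    -- the kernel is given EXPLICITLY (a `_` here sends higher-order unification into `weilFunctional`)
    exact reduction_local
      (fun x : ℝ => weilFunctional (weilTranslate
        (weilConv (fun t : ℝ => (ε : ℂ)⁻¹ * ((expNegInvGlue (1 - (t / ε) ^ 2) : ℝ) : ℂ))
          (weilReflect (fun t : ℝ => (ε : ℂ)⁻¹ * ((expNegInvGlue (1 - (t / ε) ^ 2) : ℝ) : ℂ)))) x))
      S hS (n₀ ε S) (fun n' hn' θ' => h ε hε S hS n' hn' θ') _ hT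
      (fun d => Complex.exp (I * ((∑ p ∈ S, θ p * (d.factorization p : ℝ) : ℝ) : ℂ)))

end Summit.RiemannHypothesis.RiemannHypothesis.Theorems.WeilCombBohrFejer

end
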